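import Summits.CriticalPhenomena.PercolationContinuityZ3.Theorems.PercNearOneGluingNoHeavyLowerTailAPLTwoSidedTransfer
import HarnessLib

/-!
# `NoHeavyLowerTail` (stmt-CriticalPhenomena-4575) — TWO-SIDED PARALLEL COMPOSITION V: THE COMPOSITION THEOREM U(28/27)

Support file (prover prim-ineq-gen-8 gen 60; `--supports stmt-CriticalPhenomena-4575`; memo
run/shared/lean/prim/prim-ineq-gen-8/FINDING-gen60-TWOSIDED.md §6).  No definitions, no named facts, no sorries.

**THEOREM (`twoSided_comp_le`).**  The 3-terminal union (parallel composition at the apex `o` and the ports `u, v`) of two valid pieces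
which satisfy the Harris inequality at all three terminals and `E ≤ 28/27` satisfies `E ≤ 28/27`.  Together with `series_reduction`
(cut vertices / beads / apex edges at ports) this is the closure of `E ≤ 28/27` under every series–parallel step (memos gen 57–60: the
SP theorem); `28/27` is sharp (`shortcut_first_order_sharp`).  Cell notation as in files I–IV: `x = (x₀,B,A,m,τ)`, `y = (y₀,B′,A′,m′,τ′)`,
`O_x = x₀+m`, `p_x = τ+B`, `π_x = τ+A`; Harris at `o`: `(τ+B)(τ+A) ≤ τ`, at `u`: `(τ+B)(m+τ) ≤ τ`, at `v`: `(τ+A)(m+τ) ≤ τ`.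

Proof (memo §6; all steps elementary):
* `port_v_poly`, `port_v_sqrt` — Harris at `v` gives `mA ≤ τ(x₀+B)`, whence `O(p+2m)² ≥ 4m²`, i.e. `2m(1−√O) ≤ p√O`: the conditional
  shortcut `w = m/O` is small when the apex rarely reaches `u` relative to `√O` (mirror `port_u_sqrt`);
* `comp_p_ge` — with `s_• = √O_•`: `p_z ≥ s_y·p_{x′} + s_x·p_{y′}` where `x′ = x ⊙ e_{m′/O_y}`, `y′ = y ⊙ e_{m/O_x}` are the conditional
  shortcuts of file IV (`p_{x′} = p_x + (m′/O_y)A`); indeed `p_z − s_yp_{x′} − s_xp_{y′} ≥ ½p_x(1−s_y)² + ½p_y(1−s_x)²` after the previous step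
  (mirror `comp_pi_ge`);
* Cauchy–Schwarz: `p_zπ_z ≥ (√(O_yP_{x′}) + √(O_xP_{y′}))²`, and `Q_x = (1−p_x)(1−π_x) ≤ O_x` (Harris at `o`) turns this into the hypothesis
  (b′) of `twoSided_of_transfer`, which concludes. [this work]
-/

namespace Summit.CriticalPhenomena.PercolationContinuityZ3.Theorems

namespace APL

/-- **Port-Harris bound, polynomial form.**  For cells `x₀,B,A,m,τ ≥ 0` summing to `1` with Harris at `v` (`(τ+A)(m+τ) ≤ τ`, i.e.
`P(v↔o, v↔u) ≥ P(v↔o)P(v↔u)`): `4m² ≤ (x₀+m)·((τ+B) + 2m)²`.  (`O(p+2m)² − 4m² = Op² + 4x₀pm − 4m²A` and `mA ≤ τ(x₀+B)`.) [this work] -/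
theorem port_v_poly (x0 B A m τ : ℝ) (h0 : 0 ≤ x0) (hB : 0 ≤ B) (hm : 0 ≤ m)
    (hsum : x0 + B + A + m + τ = 1) (hHv : (τ + A) * (m + τ) ≤ τ) :
    4 * m ^ 2 ≤ (x0 + m) * ((τ + B) + 2 * m) ^ 2 := by
  have hx0 : x0 = 1 - B - A - m - τ := by linarith
  have hmA : m * A ≤ τ * (x0 + B) := by rw [hx0]; nlinarith [hHv]
  have e : (x0 + m) * ((τ + B) + 2 * m) ^ 2 - 4 * m ^ 2 = (x0 + m) * (τ + B) ^ 2 + 4 * x0 * (τ + B) * m - 4 * m ^ 2 * A := by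
    rw [hx0]; ring
  have h1 : 4 * m ^ 2 * A ≤ 4 * m * (τ * (x0 + B)) := by nlinarith [mul_le_mul_of_nonneg_left hmA (by positivity : (0:ℝ) ≤ 4 * m)]
  have h2 : 4 * τ * B ≤ (τ + B) ^ 2 := by nlinarith [sq_nonneg (τ - B)]
  have h3 : 4 * m * (τ * (x0 + B)) ≤ 4 * x0 * (τ + B) * m + (x0 + m) * (τ + B) ^ 2 := by
    have h31 : 4 * m * τ * x0 ≤ 4 * x0 * (τ + B) * m := by nlinarith [mul_nonneg (mul_nonneg hm h0) hB]
    have h32 : 4 * m * τ * B ≤ (x0 + m) * (τ + B) ^ 2 := by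
      calc 4 * m * τ * B = m * (4 * τ * B) := by ring
        _ ≤ m * (τ + B) ^ 2 := mul_le_mul_of_nonneg_left h2 hm
        _ ≤ (x0 + m) * (τ + B) ^ 2 := by nlinarith [mul_nonneg h0 (sq_nonneg (τ + B))]
    nlinarith [h31, h32]
  nlinarith [e, h1, h3]

/-- **Port-Harris bound at `v`, square-root form**: with `s ≥ 0`, `s² = x₀+m` (`s = √O`): `2m ≤ s·((τ+B) + 2m)`, i.e. `2m(1−√O) ≤ p√O`. [this work] -/
theorem port_v_sqrt (x0 B A m τ s : ℝ) (h0 : 0 ≤ x0) (hB : 0 ≤ B) (hm : 0 ≤ m) (hτ : 0 ≤ τ)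
    (hsum : x0 + B + A + m + τ = 1) (hHv : (τ + A) * (m + τ) ≤ τ) (hs : 0 ≤ s) (hs2 : s ^ 2 = x0 + m) :
    2 * m ≤ s * ((τ + B) + 2 * m) := by
  have hp := port_v_poly x0 B A m τ h0 hB hm hsum hHv
  have hsq : (2 * m) ^ 2 ≤ (s * ((τ + B) + 2 * m)) ^ 2 := by
    have e1 : (2 * m) ^ 2 = 4 * m ^ 2 := by ring
    have e2 : (s * ((τ + B) + 2 * m)) ^ 2 = s ^ 2 * ((τ + B) + 2 * m) ^ 2 := by ring
    rw [e1, e2, hs2]; exact hp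
  have hR : 0 ≤ s * ((τ + B) + 2 * m) := by positivity
  calc 2 * m = Real.sqrt ((2 * m) ^ 2) := (Real.sqrt_sq (by positivity)).symm
    _ ≤ Real.sqrt ((s * ((τ + B) + 2 * m)) ^ 2) := Real.sqrt_le_sqrt hsq
    _ = s * ((τ + B) + 2 * m) := Real.sqrt_sq hR

/-- **Port-Harris bound at `u`, square-root form** (mirror): Harris at `u` (`(τ+B)(m+τ) ≤ τ`) gives `2m ≤ s·((τ+A) + 2m)`. [this work] -/
theorem port_u_sqrt (x0 B A m τ s : ℝ) (h0 : 0 ≤ x0) (hA : 0 ≤ A) (hm : 0 ≤ m) (hτ : 0 ≤ τ)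
    (hsum : x0 + B + A + m + τ = 1) (hHu : (τ + B) * (m + τ) ≤ τ) (hs : 0 ≤ s) (hs2 : s ^ 2 = x0 + m) :
    2 * m ≤ s * ((τ + A) + 2 * m) :=
  port_v_sqrt x0 A B m τ s h0 hA hm hτ (by linarith) hHu hs hs2

/-- **`p_z ≥ √O_y·p_{x′} + √O_x·p_{y′}`** (the transfer inequality for the port probability `p = P(o↔u)`): for valid `x, y` (sums `1`) with
Harris at `v` on both sides, `s_x = √O_x > 0`, `s_y = √O_y > 0`, and the conditional shortcuts `p_{x′} = τ+B + (m′/O_y)A`,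
`p_{y′} = τ′+B′ + (m/O_x)A′`: `s_y p_{x′} + s_x p_{y′} ≤ p_z = z_τ + z_B`; the slack is at least `½p_x(1−s_y)² + ½p_y(1−s_x)²`. [this work] -/
theorem comp_p_ge (x0 B A m τ y0 B' A' m' τ' sx sy zB zτ : ℝ)
    (h0 : 0 ≤ x0) (hB : 0 ≤ B) (hA : 0 ≤ A) (hm : 0 ≤ m) (hτ : 0 ≤ τ) (hsum : x0 + B + A + m + τ = 1)
    (h0' : 0 ≤ y0) (hB' : 0 ≤ B') (hA' : 0 ≤ A') (hm' : 0 ≤ m') (hτ' : 0 ≤ τ') (hsum' : y0 + B' + A' + m' + τ' = 1)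
    (hHv : (τ + A) * (m + τ) ≤ τ) (hHv' : (τ' + A') * (m' + τ') ≤ τ')
    (hsx : 0 < sx) (hsx2 : sx ^ 2 = x0 + m) (hsy : 0 < sy) (hsy2 : sy ^ 2 = y0 + m')
    (hzB : zB = x0 * B' + B * y0 + B * B')
    (hzτ : zτ = τ * (y0 + B' + A' + m' + τ') + (x0 + B + A + m) * τ' + B * (A' + m') + A * (B' + m') + m * (B' + A')) :
    sy * ((τ + B) + m' / (y0 + m') * A) + sx * ((τ' + B') + m / (x0 + m) * A') ≤ zτ + zB := by
  have Lx := port_v_sqrt x0 B A m τ sx h0 hB hm hτ hsum hHv hsx.le hsx2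
  have Ly := port_v_sqrt y0 B' A' m' τ' sy h0' hB' hm' hτ' hsum' hHv' hsy.le hsy2
  -- s·(m/O) = m/s and m/s ≤ m + p/2
  have ey : sy * (m' / (y0 + m') * A) = m' / sy * A := by
    rw [← hsy2]; field_simp
  have ex : sx * (m / (x0 + m) * A') = m / sx * A' := by
    rw [← hsx2]; field_simp
  have hy1 : m' / sy ≤ m' + (τ' + B') / 2 := by
    rw [div_le_iff₀ hsy]; nlinarith [Ly]
  have hx1 : m / sx ≤ m + (τ + B) / 2 := by
    rw [div_le_iff₀ hsx]; nlinarith [Lx]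
  have hy2 : m' / sy * A ≤ (m' + (τ' + B') / 2) * A := mul_le_mul_of_nonneg_right hy1 hA
  have hx2 : m / sx * A' ≤ (m + (τ + B) / 2) * A' := mul_le_mul_of_nonneg_right hx1 hA'
  -- the polynomial remainder: p_z − [s_y p_x + (m′ + p_y/2)A + s_x p_y + (m + p_x/2)A′] = ½ p_x (1−s_y)² + ½ p_y (1−s_x)²
  have hx0 : x0 = sx ^ 2 - m := by linarith
  have hy0 : y0 = sy ^ 2 - m' := by linarith
  have hτe : τ = 1 - sx ^ 2 - B - A := by linarith
  have hτe' : τ' = 1 - sy ^ 2 - B' - A' := by linarith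
  have erem : zτ + zB - (sy * (τ + B) + (m' + (τ' + B') / 2) * A + sx * (τ' + B') + (m + (τ + B) / 2) * A')
      = (τ + B) * (1 - sy) ^ 2 / 2 + (τ' + B') * (1 - sx) ^ 2 / 2 := by
    rw [hzτ, hzB, hx0, hy0, hτe, hτe']; ring
  have hrem : 0 ≤ (τ + B) * (1 - sy) ^ 2 / 2 + (τ' + B') * (1 - sx) ^ 2 / 2 := by positivity
  calc sy * ((τ + B) + m' / (y0 + m') * A) + sx * ((τ' + B') + m / (x0 + m) * A')
      = sy * (τ + B) + sy * (m' / (y0 + m') * A) + (sx * (τ' + B') + sx * (m / (x0 + m) * A')) := by ring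
    _ = sy * (τ + B) + m' / sy * A + (sx * (τ' + B') + m / sx * A') := by rw [ey, ex]
    _ ≤ sy * (τ + B) + (m' + (τ' + B') / 2) * A + (sx * (τ' + B') + (m + (τ + B) / 2) * A') := by linarith [hy2, hx2]
    _ ≤ zτ + zB := by linarith [erem, hrem]

/-- **`π_z ≥ √O_y·π_{x′} + √O_x·π_{y′}`** (mirror of `comp_p_ge`, Harris at `u` on both sides). [this work] -/
theorem comp_pi_ge (x0 B A m τ y0 B' A' m' τ' sx sy zA zτ : ℝ)
    (h0 : 0 ≤ x0) (hB : 0 ≤ B) (hA : 0 ≤ A) (hm : 0 ≤ m) (hτ : 0 ≤ τ) (hsum : x0 + B + A + m + τ = 1)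
    (h0' : 0 ≤ y0) (hB' : 0 ≤ B') (hA' : 0 ≤ A') (hm' : 0 ≤ m') (hτ' : 0 ≤ τ') (hsum' : y0 + B' + A' + m' + τ' = 1)
    (hHu : (τ + B) * (m + τ) ≤ τ) (hHu' : (τ' + B') * (m' + τ') ≤ τ')
    (hsx : 0 < sx) (hsx2 : sx ^ 2 = x0 + m) (hsy : 0 < sy) (hsy2 : sy ^ 2 = y0 + m')
    (hzA : zA = x0 * A' + A * y0 + A * A')
    (hzτ : zτ = τ * (y0 + B' + A' + m' + τ') + (x0 + B + A + m) * τ' + B * (A' + m') + A * (B' + m') + m * (B' + A')) :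
    sy * ((τ + A) + m' / (y0 + m') * B) + sx * ((τ' + A') + m / (x0 + m) * B') ≤ zτ + zA := by
  have hzτ' : zτ = τ * (y0 + A' + B' + m' + τ') + (x0 + A + B + m) * τ' + A * (B' + m') + B * (A' + m') + m * (A' + B') := by
    rw [hzτ]; ring
  exact comp_p_ge x0 A B m τ y0 A' B' m' τ' sx sy zA zτ h0 hA hB hm hτ (by linarith) h0' hA' hB' hm' hτ' (by linarith)
    hHu hHu' hsx hsx2 hsy hsy2 hzA hzτ'

/-- Two-term Cauchy–Schwarz in the form used below: for `a₁,a₂,b₁,b₂ ≥ 0`, `(√(a₁b₁) + √(a₂b₂))² ≤ (a₁+a₂)(b₁+b₂)`. [folklore] -/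
private theorem cs_two (a₁ a₂ b₁ b₂ : ℝ) (ha₁ : 0 ≤ a₁) (ha₂ : 0 ≤ a₂) (hb₁ : 0 ≤ b₁) (hb₂ : 0 ≤ b₂) :
    (Real.sqrt (a₁ * b₁) + Real.sqrt (a₂ * b₂)) ^ 2 ≤ (a₁ + a₂) * (b₁ + b₂) := by
  have h1 : Real.sqrt (a₁ * b₁) ^ 2 = a₁ * b₁ := Real.sq_sqrt (by positivity)
  have h2 : Real.sqrt (a₂ * b₂) ^ 2 = a₂ * b₂ := Real.sq_sqrt (by positivity)
  have h3 : 2 * (Real.sqrt (a₁ * b₁) * Real.sqrt (a₂ * b₂)) ≤ a₁ * b₂ + a₂ * b₁ := by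
    have e : Real.sqrt (a₁ * b₁) * Real.sqrt (a₂ * b₂) = Real.sqrt (a₁ * b₂) * Real.sqrt (a₂ * b₁) := by
      rw [← Real.sqrt_mul (by positivity), ← Real.sqrt_mul (by positivity)]; congr 1; ring
    rw [e]
    nlinarith [sq_nonneg (Real.sqrt (a₁ * b₂) - Real.sqrt (a₂ * b₁)), Real.sq_sqrt (by positivity : 0 ≤ a₁ * b₂),
      Real.sq_sqrt (by positivity : 0 ≤ a₂ * b₁)]
  nlinarith [h1, h2, h3]

/-- **THE TWO-SIDED COMPOSITION THEOREM U(28/27).**  Let `x = (x₀,B,A,m,τ)` and `y = (y₀,B′,A′,m′,τ′)` be valid pieces (cells `≥ 0`,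
sums `1`, `O_x = x₀+m > 0`, `O_y = y₀+m′ > 0`) satisfying the Harris inequality at the apex and at both ports, each with `E ≤ 28/27`.
Then their parallel composition `z` (3-terminal union; cells `z_B, z_A, z_m, z_τ` as in file I) has `E ≤ 28/27`:
`(z_τ − p_zπ_z)² ≤ (28/27)·p_zπ_z·z_m`.  Proof: `comp_p_ge`, `comp_pi_ge`, Cauchy–Schwarz and `Q_x ≤ O_x` give the inequality (b′), and
`twoSided_of_transfer` (file IV) concludes.  With `series_reduction` this closes `E ≤ 28/27` under all series–parallel operations; the
constant is sharp. [this work] -/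
theorem twoSided_comp_le (x0 B A m τ y0 B' A' m' τ' zB zA zm zτ : ℝ)
    (h0 : 0 ≤ x0) (hB : 0 ≤ B) (hA : 0 ≤ A) (hm : 0 ≤ m) (hτ : 0 ≤ τ) (hsum : x0 + B + A + m + τ = 1)
    (h0' : 0 ≤ y0) (hB' : 0 ≤ B') (hA' : 0 ≤ A') (hm' : 0 ≤ m') (hτ' : 0 ≤ τ') (hsum' : y0 + B' + A' + m' + τ' = 1)
    (hOx : 0 < x0 + m) (hOy : 0 < y0 + m')
    (hH : (τ + B) * (τ + A) ≤ τ) (hHu : (τ + B) * (m + τ) ≤ τ) (hHv : (τ + A) * (m + τ) ≤ τ)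
    (hH' : (τ' + B') * (τ' + A') ≤ τ') (hHu' : (τ' + B') * (m' + τ') ≤ τ') (hHv' : (τ' + A') * (m' + τ') ≤ τ')
    (hE : (τ - (τ + B) * (τ + A)) ^ 2 ≤ 28 / 27 * ((τ + B) * (τ + A)) * m)
    (hE' : (τ' - (τ' + B') * (τ' + A')) ^ 2 ≤ 28 / 27 * ((τ' + B') * (τ' + A')) * m')
    (hzB : zB = x0 * B' + B * y0 + B * B') (hzA : zA = x0 * A' + A * y0 + A * A') (hzm : zm = x0 * m' + m * y0 + m * m')
    (hzτ : zτ = τ * (y0 + B' + A' + m' + τ') + (x0 + B + A + m) * τ' + B * (A' + m') + A * (B' + m') + m * (B' + A')) :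
    (zτ - (zτ + zB) * (zτ + zA)) ^ 2 ≤ 28 / 27 * ((zτ + zB) * (zτ + zA)) * zm := by
  -- square roots of O_x, O_y
  obtain ⟨sx, hsxd⟩ : ∃ t : ℝ, t = Real.sqrt (x0 + m) := ⟨_, rfl⟩
  obtain ⟨sy, hsyd⟩ : ∃ t : ℝ, t = Real.sqrt (y0 + m') := ⟨_, rfl⟩
  have hsx : 0 < sx := by rw [hsxd]; exact Real.sqrt_pos.2 hOx
  have hsy : 0 < sy := by rw [hsyd]; exact Real.sqrt_pos.2 hOy
  have hsx2 : sx ^ 2 = x0 + m := by rw [hsxd]; exact Real.sq_sqrt hOx.le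
  have hsy2 : sy ^ 2 = y0 + m' := by rw [hsyd]; exact Real.sq_sqrt hOy.le
  -- the conditional-shortcut port probabilities
  obtain ⟨p1, hp1⟩ : ∃ t : ℝ, t = (τ + B) + m' / (y0 + m') * A := ⟨_, rfl⟩
  obtain ⟨q1, hq1⟩ : ∃ t : ℝ, t = (τ + A) + m' / (y0 + m') * B := ⟨_, rfl⟩
  obtain ⟨p2, hp2⟩ : ∃ t : ℝ, t = (τ' + B') + m / (x0 + m) * A' := ⟨_, rfl⟩
  obtain ⟨q2, hq2⟩ : ∃ t : ℝ, t = (τ' + A') + m / (x0 + m) * B' := ⟨_, rfl⟩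
  have hp10 : 0 ≤ p1 := by rw [hp1]; positivity
  have hq10 : 0 ≤ q1 := by rw [hq1]; positivity
  have hp20 : 0 ≤ p2 := by rw [hp2]; positivity
  have hq20 : 0 ≤ q2 := by rw [hq2]; positivity
  have hpz := comp_p_ge x0 B A m τ y0 B' A' m' τ' sx sy zB zτ h0 hB hA hm hτ hsum h0' hB' hA' hm' hτ' hsum' hHv hHv' hsx hsx2 hsy hsy2 hzB hzτ
  have hπz := comp_pi_ge x0 B A m τ y0 B' A' m' τ' sx sy zA zτ h0 hB hA hm hτ hsum h0' hB' hA' hm' hτ' hsum' hHu hHu' hsx hsx2 hsy hsy2 hzA hzτ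
  rw [← hp1, ← hp2] at hpz
  rw [← hq1, ← hq2] at hπz
  -- Cauchy–Schwarz: p_z π_z ≥ (√(O_y P_{x′}) + √(O_x P_{y′}))²
  have hcs := cs_two (sy * p1) (sx * p2) (sy * q1) (sx * q2) (by positivity) (by positivity) (by positivity) (by positivity)
  have hprod : (sy * p1 + sx * p2) * (sy * q1 + sx * q2) ≤ (zτ + zB) * (zτ + zA) :=
    mul_le_mul hpz hπz (by positivity) (le_trans (by positivity) hpz)
  -- identify the two products
  have e1 : sy * p1 * (sy * q1) = (y0 + m') * (p1 * q1) := by rw [← hsy2]; ring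
  have e2 : sx * p2 * (sx * q2) = (x0 + m) * (p2 * q2) := by rw [← hsx2]; ring
  rw [e1, e2] at hcs
  -- Q_x ≤ O_x (Harris at o) :  P₂ = Q_x² P_{y′}/O_x ≤ O_x P_{y′}
  have hx0 : x0 = 1 - B - A - m - τ := by linarith
  have hQ : (x0 + m + A) * (x0 + m + B) ≤ x0 + m := by
    have e : (x0 + m) - (x0 + m + A) * (x0 + m + B) = τ - (τ + B) * (τ + A) := by rw [hx0]; ring
    linarith [e, sub_nonneg.2 hH]
  have hQ0 : 0 ≤ (x0 + m + A) * (x0 + m + B) := by positivity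
  have hP2le : ((x0 + m + A) * (x0 + m + B)) ^ 2 * (p2 * q2) / (x0 + m) ≤ (x0 + m) * (p2 * q2) := by
    rw [div_le_iff₀ hOx]
    have h1 : ((x0 + m + A) * (x0 + m + B)) ^ 2 ≤ (x0 + m) ^ 2 := pow_le_pow_left₀ hQ0 hQ 2
    have h2 : 0 ≤ p2 * q2 := by positivity
    calc ((x0 + m + A) * (x0 + m + B)) ^ 2 * (p2 * q2) ≤ (x0 + m) ^ 2 * (p2 * q2) := mul_le_mul_of_nonneg_right h1 h2
      _ = (x0 + m) * (p2 * q2) * (x0 + m) := by ring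
  have hsqrt2 : Real.sqrt (((x0 + m + A) * (x0 + m + B)) ^ 2 * (p2 * q2) / (x0 + m)) ≤ Real.sqrt ((x0 + m) * (p2 * q2)) :=
    Real.sqrt_le_sqrt hP2le
  have hb : (Real.sqrt ((y0 + m') * (p1 * q1)) + Real.sqrt (((x0 + m + A) * (x0 + m + B)) ^ 2 * (p2 * q2) / (x0 + m))) ^ 2
      ≤ (zτ + zB) * (zτ + zA) := by
    have hA1 : 0 ≤ Real.sqrt ((y0 + m') * (p1 * q1)) := Real.sqrt_nonneg _
    have hA2 : 0 ≤ Real.sqrt (((x0 + m + A) * (x0 + m + B)) ^ 2 * (p2 * q2) / (x0 + m)) := Real.sqrt_nonneg _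
    have hle : Real.sqrt ((y0 + m') * (p1 * q1)) + Real.sqrt (((x0 + m + A) * (x0 + m + B)) ^ 2 * (p2 * q2) / (x0 + m))
        ≤ Real.sqrt ((y0 + m') * (p1 * q1)) + Real.sqrt ((x0 + m) * (p2 * q2)) := by linarith [hsqrt2]
    calc (Real.sqrt ((y0 + m') * (p1 * q1)) + Real.sqrt (((x0 + m + A) * (x0 + m + B)) ^ 2 * (p2 * q2) / (x0 + m))) ^ 2
        ≤ (Real.sqrt ((y0 + m') * (p1 * q1)) + Real.sqrt ((x0 + m) * (p2 * q2))) ^ 2 :=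
          pow_le_pow_left₀ (by positivity) hle 2
      _ ≤ (sy * p1 + sx * p2) * (sy * q1 + sx * q2) := hcs
      _ ≤ (zτ + zB) * (zτ + zA) := hprod
  -- conclude with the transfer theorem of file IV
  exact twoSided_of_transfer x0 B A m τ y0 B' A' m' τ' zB zA zm zτ ((y0 + m') * (p1 * q1))
    (((x0 + m + A) * (x0 + m + B)) ^ 2 * (p2 * q2) / (x0 + m))
    h0 hB hA hm hτ hsum h0' hB' hA' hm' hτ' hsum' hOx hOy hH hE hH' hE' hzB hzA hzm hzτ
    (by rw [hp1, hq1]) (by rw [hp2, hq2]) hb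

end APL

end Summit.CriticalPhenomena.PercolationContinuityZ3.Theorems
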